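import Summits.QuantumFields.YangMills.Theorems.UnitScaleTiltFluctuationComparisonRegPrGlobalSlackCanonicalPolymersCore
import Summits.QuantumFields.YangMills.Theorems.UnitScaleTiltFluctuationComparisonRegPrRepAtHeightsCoreRowsFam
import HarnessLib

/-!
# `UnitScaleTiltFluctuationComparisonRegPrGlobalSlackCanonicalPolymersCoreV4` — THE v4 TWIN (★★OWNER RULING g26-№14 (F-2b); BILL §7 P22b «20520 supplier side») of
# `…GlobalSlackCanonicalPolymersCore` (p57xxxx-lineage, ★r1 g4): THE CANONICAL POLYMERISATION OVER THE ROWS RECORD `PkgCoreRows`, AND (43) AT THE TRIVIAL HISTORY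
# (crux `FluctuationComparisonRegPrIntL`, stmt-QuantumFields-20520, skeleton v5kD: STUB 3⁗χ(v4) `stub_globalTwoRunSlackFamChiV4` and STUB (i*)χ(v4) `stub_smallBlocksSlackOnChiAllChiV4`;
# cell ym3-torus, width seat ym-ust-20520-w2 g4)

WHY A TWIN.  The v5kD stubs 3⁗χ(v4) ∕ (i*)χ(v4) read the v4 χ-record's datum `AlphaInputsT3AC.dataOfV4chi p π`, which IS `AlphaInputsT3AC.dataOfCoreRows (fun K ↦ (p K).toRows) π`
(`…RepAtHeightsChiV4Fam`, an `abbrev`).  The canonical polymerisation `canonPolymerCore q` ∕ `canonPTCore q` and its (43) row are stated over `q : ∀ K, PkgCoreV3 …` (whose `runCore`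
carries the located-unsuppliable comb (67)-row, 19936 evidence #60) and therefore reach NEITHER v4 stub.  They read the package only through data fields (`𝔖`, `𝔄`, the AC tower `T`)
and the χ-free step rows `hPY`∕`hPYZ` of `AlphaV3AC.StepAlphaV3CoreAC` — all present in `PkgCoreRows` (`runRows.steps`) — so this file states them ONCE over the rows record:

* §1 `newDomsRows q`, `canonLocRows q`, `canonTreeLenRows q`, **`canonPolymerRows q`**, `newTermRows q`, `oldTermRows q`, **`canonPTRows q`** for `q : ∀ K, PkgCoreRows F 𝔠 γ hγ hγ1 K` —
  `…CanonicalPolymersCore` §1 VERBATIM with `PkgCoreV3 ↦ PkgCoreRows`;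
* §2 **`pintDecompTrivT_canonRows : PintDecompTrivT (dataOfCoreRows q (canonPolymerRows q)) (canonPTRows q)`** — (43) at the trivial history for EVERY family of rows records
  (proof verbatim with `runCore.steps ↦ runRows.steps`);
* §3 NOTHING LOST: the v3 core objects are the instances along `PkgCoreV3.toRows` (definitional): `dataOfCoreV3_eq_rows`, `newDomsCore_eq_rows`, `canonLocCore_eq_rows`,
  `canonTreeLenCore_eq_rows`, `canonPolymerCore_eq_rows`, `newTermCore_eq_rows`, `oldTermCore_eq_rows`, `canonPTCore_eq_rows` — so every landed theorem about `canonPolymerCore q` is a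
  special case, and the v4 χ-record's canonical polymerisation is `canonPolymerRows (fun K ↦ (p K).toRows)` for `p : ∀ K, PkgAtV4Chi …`.
DEFINITIONS + bookkeeping identities; no estimate; nothing of [Balaban1985UV3] is asserted beyond the record's own rows.  YM₃ on T³ is rung R3 of the programme, not the Clay problem.

References: T. Bałaban, CMP 102 (1985) 255–275 [Balaban1985UV3] ((24) p.262, (33) p.264, (43) p.266, (58)–(61) pp.270–271, p.272); CMP 109 (1987) 249–301 [Balaban1987RG1] ((0.1) p.251).
-/

set_option autoImplicit false

noncomputable section

namespace Summit.QuantumFields.YangMills.Theorems.GlobalSlackCanonicalPolymers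

open scoped BigOperators
open Finset
open Literature.MathematicalPhysics.QuantumFieldTheory.Balaban1983to89
open Literature.MathematicalPhysics.QuantumFieldTheory.Balaban1983to89.T3ContinuumYM3Torus
open Literature.MathematicalPhysics.QuantumFieldTheory.Balaban1983to89.T3AlphaInputsAC
open Literature.MathematicalPhysics.QuantumFieldTheory.Balaban1983to89.T3AlphaInputsACTwoRunLevel
open Literature.MathematicalPhysics.QuantumFieldTheory.Balaban1983to89.TreeLengthTorus (tsys)
open Literature.MathematicalPhysics.QuantumFieldTheory.Balaban1985CMP102
open Literature.MathematicalPhysics.QuantumFieldTheory.Balaban1985CMP102.Setting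
open Summit.QuantumFields.Balaban3D.Carriers
open Summit.QuantumFields.Balaban3D.Proofs.Primitives
open Summit.QuantumFields.Balaban3D.Proofs.Representation33 (jet26)
open Summit.QuantumFields.YangMills.Theorems

variable {F : T3Family} {𝔠 : AlphaConsts F.L (suGroupModel 2).N} {γ : ℝ} {hγ : 0 < γ} {hγ1 : γ ≤ (min 𝔠.gamma0 1) ^ 2}

variable (q : ∀ K, AlphaInputsT3AC.PkgCoreRows F 𝔠 γ hγ hγ1 K)

/-- The retained localisation domains of the new terms born at step `k` of run `K`, history `h` ((59): inside `Ω_{k+1}(h)`, tree length `< R₁r(g_k)`). [cite: Balaban1985UV3, (59) p.270] -/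
abbrev newDomsRows (K k : ℕ) (h : Hist (F.P K) (k + 1)) : Finset (tsys 3 (nblkOf (SK F 𝔠 γ hγ hγ1 K) 𝔠.lane.carrier k)).Dom :=
  ((q K).𝔖 k).loc (ΩblkOf 𝔠.lane.carrier.M₁ (rcolOf (SK F 𝔠 γ hγ hγ1 K) 𝔠.lane.carrier) (nblkOf (SK F 𝔠 γ hγ hγ1 K) 𝔠.lane.carrier k))
    (rretOf (SK F 𝔠 γ hγ hγ1 K) 𝔠.lane.carrier k) h

/-! ## §1 The canonical polymerisation and term function of a family of rows records -/

open Classical in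
/-- THE LOCALISATION DOMAINS OF THE CANONICAL POLYMERISATION of run `K` at lattice level `j`, history `h`, term level `i`: no terms at level `0`; at level `k+1`,
the new terms (`i = k+1`) in the point sets of the retained domains, the old terms (`1 ≤ i ≤ k`) block by block; above the top (`K < k+1`, where the package
has no step rows and no socket row reads) ONE dummy domain (the whole torus) at term level `1`, so that the volume row holds there too. [cite: Balaban1985UV3, (43) p.266, (59) p.270] -/
def canonLocRows (K j : ℕ) (h : Hist (F.P K) j) (i : ℕ) : Finset (Set (Site (F.P K) 0)) :=
  match j, h with
  | 0, _ => ∅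
  | k + 1, h =>
    if k + 1 ≤ K then
      (if i = k + 1 then (newDomsRows q K k h).image (domSet (F := F) 𝔠.lane.carrier.M₁ K k)
       else if i ∈ Finset.Icc 1 k then
         (oldBlocks 𝔠.lane.carrier.M₁ (rcolOf (SK F 𝔠 γ hγ hγ1 K) 𝔠.lane.carrier) h i).image (blockSet K i)
       else ∅)
    else (if i = 1 then {Set.univ} else ∅)

open Classical in
/-- THE TREE LENGTH of a point set at term level `i` of run `K`: the infimum of `tsys.dj` over the step-`(i−1)` domains with that point set (`0` if there is none —
block domains). [cite: Balaban1985UV3, (24)–(25) p.262, (59) p.270] -/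
def canonTreeLenRows (K i : ℕ) (Y : Set (Site (F.P K) 0)) : ℝ :=
  sInf ((fun X => (tsys 3 ((q K).𝔖 (i - 1)).Nblk).dj X) ''
    {X : (tsys 3 ((q K).𝔖 (i - 1)).Nblk).Dom | domSet (F := F) 𝔠.lane.carrier.M₁ K (i - 1) X = Y})

/-- **THE CANONICAL POLYMERISATION OF THE FAMILY OF ROWS RECORDS `q`** as a polymer parameter of the interface: `Loc := canonLocRows`, `treeLen := canonTreeLenRows`; the fine-field term
`Pterm` and the enlargement `enl` are PLACEHOLDERS (`0`, `id`) — the coarse-field T-socket of 3⁗ (`PintDecompTrivT`/`TermSizeTrivT`/`PolymerCauchyMinAtT…`) never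
reads them. [cite: Balaban1985UV3, (43) p.266] -/
def canonPolymerRows : AlphaInputsT3AC.PolymerT3 F where
  Loc := canonLocRows q
  Pterm := fun _ _ _ _ => 0
  enl := fun _ _ Y => Y
  treeLen := canonTreeLenRows q



/-- THE NEW TERM OF A RETAINED DOMAIN at the trivial history: `Re jet26(Ψ_X)(B_X(triv, W)) − far_X(triv, W)` for the step charts AND the G3D-07 charts `Λc`
(the summands of `hPY` and `hPYZ`). [cite: Balaban1985UV3, (33) p.264, (60)–(61) p.271] -/
def newTermRows (K k : ℕ) (X : (tsys 3 (nblkOf (SK F 𝔠 γ hγ hγ1 K) 𝔠.lane.carrier k)).Dom)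
    (W : GaugeField (F.P K) (k + 1) (Matrix.specialUnitaryGroup (Fin 2) ℂ)) : ℝ :=
  ((jet26 (((q K).𝔖 k).Ψ X) (((q K).𝔖 k).Bcfg X (Hist.triv (F.P K) (k + 1)) W)).re - ((q K).𝔖 k).far X (Hist.triv (F.P K) (k + 1)) W) +
  ((jet26 (((q K).𝔄.Λc k).Ψ X) (((q K).𝔖 k).Bcfg X (Hist.triv (F.P K) (k + 1)) W)).re - ((q K).𝔄.Λc k).far X (Hist.triv (F.P K) (k + 1)) W)

/-- THE OLD TERM OF A BLOCK at the trivial history: the lane's `oldVal` of level `i`, block `y`, summed over degrees `n ≤ Ndeg i` and bond tuples in the collar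
(`Carriers.oldSumIn`'s summand; nothing is dropped at the trivial history). [cite: Balaban1985UV3, (43) p.266, (58) p.270] -/
def oldTermRows (K k i : ℕ) (y : Site (F.P K) i) (W : GaugeField (F.P K) (k + 1) (Matrix.specialUnitaryGroup (Fin 2) ℂ)) : ℝ :=
  ∑ n ∈ range (((q K).𝔖 k).Ndeg i + 1),
    ∑ c ∈ Fintype.piFinset (fun _ : Fin n => oldBonds 𝔠.lane.carrier.M₁ (rcolOf (SK F 𝔠 γ hγ hγ1 K) 𝔠.lane.carrier) (Hist.triv (F.P K) (k + 1)) i y),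
      (if Drop 𝔠.lane.carrier.M₁ (rcolOf (SK F 𝔠 γ hγ hγ1 K) 𝔠.lane.carrier) (Hist.triv (F.P K) (k + 1)) i y n c then 0
       else ((q K).𝔖 k).oldVal (Hist.triv (F.P K) (k + 1)) W i y n c)

open Classical in
/-- **THE CANONICAL TERM FUNCTION OF THE FAMILY OF ROWS RECORDS `q`** (coarse-field-indexed, trivial history): at lattice level `k+1` of run `K`, the level-`(k+1)` term of a point set
`Y` is the sum of the new terms of the retained domains with point set `Y`, the level-`i ≤ k` term of `Y` is the sum of the old terms of the blocks with point set
`Y`; above the top the whole `Pint` sits on the dummy domain at term level `1`. [cite: Balaban1985UV3, (43) p.266] -/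
def canonPTRows : TermFn F := fun K j i Y W =>
  match j, W with
  | 0, _ => 0
  | k + 1, W =>
    if k + 1 ≤ K then
      (if i = k + 1 then
         ∑ X ∈ (newDomsRows q K k (Hist.triv (F.P K) (k + 1))).filter (fun X => domSet (F := F) 𝔠.lane.carrier.M₁ K k X = Y), newTermRows q K k X W
       else
         ∑ y ∈ (oldBlocks 𝔠.lane.carrier.M₁ (rcolOf (SK F 𝔠 γ hγ hγ1 K) 𝔠.lane.carrier) (Hist.triv (F.P K) (k + 1)) i).filter
           (fun y => blockSet K i y = Y), oldTermRows q K k i y W)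
    else (if i = 1 then (q K).T.Pint (k + 1) (Hist.triv (F.P K) (k + 1)) W else 0)

/-! ## §2 (43) at the trivial history for the canonical polymerisation of a family of rows records — a theorem -/

-- (`pint_succ_eq_core` / `pint_zero_eq_core` of `…CanonicalPolymersCore` are record-free identities of the AC tower; they are re-used below through `rfl`, not restated.)

open Classical in
/-- The old slice regrouped by blocks: `PoldIn_k(triv, W) = Σ_{i=1}^{k} Σ_{Y ∈ canonLocRows (k+1) triv i} canonPTRows (k+1) i Y W`. [cite: Balaban1985UV3, (43) p.266, (58) p.270] -/
theorem poldIn_triv_eq_sum_rows (K k : ℕ) (hk : k + 1 ≤ K) (W : GaugeField (F.P K) (k + 1) (Matrix.specialUnitaryGroup (Fin 2) ℂ)) :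
    ((q K).𝔖 k).PoldIn 𝔠.lane.carrier.M₁ (rcolOf (SK F 𝔠 γ hγ hγ1 K) 𝔠.lane.carrier) (Hist.triv (F.P K) (k + 1)) W =
      ∑ i ∈ Icc 1 k, ∑ Y ∈ canonLocRows q K (k + 1) (Hist.triv (F.P K) (k + 1)) i, canonPTRows q K (k + 1) i Y W := by
  unfold StepSeries.PoldIn oldSumIn
  refine Finset.sum_congr rfl fun i hi => ?_
  have hik : i ≠ k + 1 := by have := (Finset.mem_Icc.mp hi).2; omega
  have hloc : canonLocRows q K (k + 1) (Hist.triv (F.P K) (k + 1)) i =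
      (oldBlocks 𝔠.lane.carrier.M₁ (rcolOf (SK F 𝔠 γ hγ hγ1 K) 𝔠.lane.carrier) (Hist.triv (F.P K) (k + 1)) i).image (blockSet K i) := by
    simp only [canonLocRows, if_pos hk, if_neg hik, if_pos hi]
  have hPT : ∀ Y, canonPTRows q K (k + 1) i Y W =
      ∑ y' ∈ (oldBlocks 𝔠.lane.carrier.M₁ (rcolOf (SK F 𝔠 γ hγ hγ1 K) 𝔠.lane.carrier) (Hist.triv (F.P K) (k + 1)) i).filter
        (fun y' => blockSet K i y' = Y), oldTermRows q K k i y' W := fun Y => by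
    simp only [canonPTRows, if_pos hk, if_neg hik]
  rw [hloc, Finset.sum_image' (fun y => oldTermRows q K k i y W) (fun y _ => hPT (blockSet K i y))]
  rfl

open Classical in
/-- The new slice regrouped by point sets, `k < K`: `PY_k + PYZ_k = Σ_{Y ∈ canonLocRows (k+1) triv (k+1)} canonPTRows (k+1) (k+1) Y W` — the displayed identifications
`hPY`/`hPYZ` of the step rows and fibrewise re-indexing. [cite: Balaban1985UV3, (33) p.264, (59)–(61) pp.270–271] -/
theorem new_triv_eq_sum_rows (K k : ℕ) (hk : k + 1 ≤ K) (W : GaugeField (F.P K) (k + 1) (Matrix.specialUnitaryGroup (Fin 2) ℂ)) :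
    ((q K).𝔖 k).PY (Hist.triv (F.P K) (k + 1)) W + ((q K).𝔖 k).PYZ (Hist.triv (F.P K) (k + 1)) W =
      ∑ Y ∈ canonLocRows q K (k + 1) (Hist.triv (F.P K) (k + 1)) (k + 1), canonPTRows q K (k + 1) (k + 1) Y W := by
  have hloc : canonLocRows q K (k + 1) (Hist.triv (F.P K) (k + 1)) (k + 1) =
      (newDomsRows q K k (Hist.triv (F.P K) (k + 1))).image (domSet (F := F) 𝔠.lane.carrier.M₁ K k) := by
    simp only [canonLocRows, if_pos hk, ite_true]
  have hPT : ∀ Y, canonPTRows q K (k + 1) (k + 1) Y W =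
      ∑ X' ∈ (newDomsRows q K k (Hist.triv (F.P K) (k + 1))).filter (fun X' => domSet (F := F) 𝔠.lane.carrier.M₁ K k X' = Y),
        newTermRows q K k X' W := fun Y => by
    simp only [canonPTRows, if_pos hk, ite_true]
  have hre : ∑ Y ∈ (newDomsRows q K k (Hist.triv (F.P K) (k + 1))).image (domSet (F := F) 𝔠.lane.carrier.M₁ K k),
      canonPTRows q K (k + 1) (k + 1) Y W = ∑ X ∈ newDomsRows q K k (Hist.triv (F.P K) (k + 1)), newTermRows q K k X W :=
    Finset.sum_image' (fun X => newTermRows q K k X W) (fun X _ => hPT (domSet (F := F) 𝔠.lane.carrier.M₁ K k X))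
  have h1 := ((q K).runRows.steps k hk).hPY (Hist.triv (F.P K) (k + 1)) W
  have h2 := ((q K).runRows.steps k hk).hPYZ (Hist.triv (F.P K) (k + 1)) W
  rw [hloc, hre, h1, h2, ← Finset.sum_add_distrib]
  exact Finset.sum_congr rfl fun X _ => rfl

open Classical in
/-- **(43) AT THE TRIVIAL HISTORY FOR THE CANONICAL POLYMERISATION — A THEOREM FOR EVERY FAMILY OF ROWS RECORDS**: `PintDecompTrivT (dataOfCoreRows q (canonPolymerRows q)) (canonPTRows q)`,
i.e. `Pint K j triv W = Σ_{i=1}^{j} Σ_{Y ∈ Loc K j triv i} canonPTRows K j i Y W` for every run, level and field — the producer's first row, discharged.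
[cite: Balaban1985UV3, (43) p.266, (58)–(61) pp.270–271] -/
theorem pintDecompTrivT_canonRows : PintDecompTrivT (AlphaInputsT3AC.dataOfCoreRows q (canonPolymerRows q)) (canonPTRows q) := by
  intro K j W
  show (q K).T.Pint j (Hist.triv (F.P K) j) W = ∑ i ∈ Icc 1 j, ∑ Y ∈ canonLocRows q K j (Hist.triv (F.P K) j) i, canonPTRows q K j i Y W
  cases j with
  | zero => simp [show (q K).T.Pint 0 (Hist.triv (F.P K) 0) W = 0 from rfl]
  | succ k =>
    by_cases hk : k + 1 ≤ K
    · rw [show (q K).T.Pint (k + 1) (Hist.triv (F.P K) (k + 1)) W =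
          ((q K).𝔖 k).PoldIn 𝔠.lane.carrier.M₁ (rcolOf (SK F 𝔠 γ hγ hγ1 K) 𝔠.lane.carrier) (Hist.triv (F.P K) (k + 1)) W +
            ((q K).𝔖 k).PY (Hist.triv (F.P K) (k + 1)) W + ((q K).𝔖 k).PYZ (Hist.triv (F.P K) (k + 1)) W from rfl,
        Finset.sum_Icc_succ_top (by omega : 1 ≤ k + 1), ← poldIn_triv_eq_sum_rows q K k hk, add_assoc,
        new_triv_eq_sum_rows q K k hk W]
    · -- above the top: the whole `Pint` on the dummy domain at term level `1`
      rw [Finset.sum_eq_single_of_mem 1 (Finset.mem_Icc.mpr ⟨le_rfl, by omega⟩) (fun i _ hi1 => by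
        simp only [canonLocRows, if_neg hk, if_neg hi1, Finset.sum_empty])]
      simp only [canonLocRows, canonPTRows, if_neg hk, ite_true, Finset.sum_singleton]


/-! ## §3 Nothing lost: the v3 core objects are the instances along `PkgCoreV3.toRows` -/

section Compat

variable (p : ∀ K, AlphaInputsT3AC.PkgCoreV3 F 𝔠 γ hγ hγ1 K) (π : AlphaInputsT3AC.PolymerT3 F)

/-- **`dataOfCoreV3 p π = dataOfCoreRows (toRows ∘ p) π`** — the v3 core family datum IS the rows datum of the projected family (definitional: `toRows` keeps every data field).
[cite: Balaban1985UV3, (38)–(43) p.266] -/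
theorem dataOfCoreV3_eq_rows : AlphaInputsT3AC.dataOfCoreV3 p π = AlphaInputsT3AC.dataOfCoreRows (fun K => (p K).toRows) π := rfl

/-- `newDomsCore p = newDomsRows (toRows ∘ p)` (definitional: `toRows` keeps `𝔖`). [folklore] -/
theorem newDomsCore_eq_rows (K k : ℕ) (h : Hist (F.P K) (k + 1)) : newDomsCore p K k h = newDomsRows (fun K => (p K).toRows) K k h := rfl

/-- `canonLocCore p = canonLocRows (toRows ∘ p)` (definitional). [folklore] -/
theorem canonLocCore_eq_rows : canonLocCore p = canonLocRows (fun K => (p K).toRows) := by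
  funext K j h i
  cases j with
  | zero => rfl
  | succ k => rfl

/-- `canonTreeLenCore p = canonTreeLenRows (toRows ∘ p)` (definitional). [folklore] -/
theorem canonTreeLenCore_eq_rows : canonTreeLenCore p = canonTreeLenRows (fun K => (p K).toRows) := rfl

/-- **`canonPolymerCore p = canonPolymerRows (toRows ∘ p)`** — the canonical polymerisation of a v3 core family IS the rows one of the projected family. [folklore] -/
theorem canonPolymerCore_eq_rows : canonPolymerCore p = canonPolymerRows (fun K => (p K).toRows) := by
  rw [canonPolymerCore, canonPolymerRows, canonLocCore_eq_rows, canonTreeLenCore_eq_rows]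

/-- `newTermCore p = newTermRows (toRows ∘ p)` (definitional). [folklore] -/
theorem newTermCore_eq_rows : newTermCore p = newTermRows (fun K => (p K).toRows) := rfl

/-- `oldTermCore p = oldTermRows (toRows ∘ p)` (definitional). [folklore] -/
theorem oldTermCore_eq_rows : oldTermCore p = oldTermRows (fun K => (p K).toRows) := rfl

/-- **`canonPTCore p = canonPTRows (toRows ∘ p)`** — the canonical term function of a v3 core family IS the rows one of the projected family. [folklore] -/
theorem canonPTCore_eq_rows : canonPTCore p = canonPTRows (fun K => (p K).toRows) := by
  funext K j i Y W
  cases j with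
  | zero => rfl
  | succ k => rfl

end Compat

end Summit.QuantumFields.YangMills.Theorems.GlobalSlackCanonicalPolymers

end
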